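import Literature.AlgebraicGeometry.Morphisms.SectionsLiftOfFibreVanishing
import Literature.AlgebraicGeometry.Modules.ModuleSectionsFlatBaseChange
import Literature.AlgebraicGeometry.KTheory.PullbackVectorBundle
import HarnessLib

/-!
# Global sections span the sections of the fibre at a prime: cohomology and base change in degree `0` over an
# arbitrary affine noetherian base (Mumford, *Abelian Varieties*, §5 Cor. 3; Hartshorne III Thm. 12.11; EGA III 7.7.10)

Topic `AlgebraicGeometry/Morphisms`; namespace `Literature.AlgebraicGeometry.Morphisms`; a *proofs* file (theorems only; no
definition, no named fact, no instance, no notation).  ★ `Morphisms/SectionsLiftOfFibreVanishing` proves «sections on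
the closed fibre lift» over a LOCAL base; this file removes the locality: for `f : X → Spec A` proper and flat with `A`
noetherian, a vector bundle `G` on `X`, a prime `𝔭 ⊂ A`, and the fibre `X₀ = X ×_A κ(𝔭)` given as ANY cartesian square
`HX : IsPullback iX f₀ f (Spec.map (algebraMap A κ(𝔭)))` (`κ(𝔭) = 𝔭.ResidueField`, the shape used by the (h2) leaf
★ `Morphisms/RelativelyVeryAmpleNearFibre`), the vanishing `Ext¹_{𝒪_{X₀}}(𝒪_{X₀}, G|_{X₀}) = 0` ALONE implies

* **`span_unitSectionLE_top_eq_top_at_prime`** — `Γ(X₀, G|_{X₀})` is spanned over `Γ(Spec κ(𝔭), 𝒪) ≅ κ(𝔭)` by the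
  restrictions `η(t)` of the GLOBAL sections `t ∈ Γ(X, G)`, i.e. `Γ(X, G) ⊗_A κ(𝔭) → Γ(X₀, G|_{X₀})` is ONTO
  (Mumford §5 Cor. 3 at `p = 1` / Hartshorne III 12.11 (b) with `i = 1` / EGA III 7.7.10, at the point `𝔭`).  Since
  `κ(𝔭) = Frac(A/𝔭)`, every fibre section is a `κ(𝔭)`-unit multiple of a restricted global section — the input of
  «generation spreads off the fibre» (EGA III 4.7.1) in the Nakayama step of the consumer.

Proof: localise — `X ×_A A_𝔭 → Spec A_𝔭` is proper flat over an affine base with LOCAL noetherian ring, its closed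
fibre over `Spec κ(𝔭) → Spec A_𝔭` is `X₀` again (pasting of cartesian squares, `IsPullback.of_right`); flat base change
of `H⁰` along `Spec A_𝔭 → Spec A` (★ `Modules/ModuleSectionsFlatBaseChange.span_unitSectionLE_top_eq_top_of_flat`); the
local-base theorem (★ `Morphisms/SectionsLiftOfFibreVanishing.span_unitSectionLE_top_eq_top_of_subsingleton_ext`) with the
residue-field identification `κ(Γ(Spec A_𝔭, 𝒪)) ≅ Γ(Spec κ(𝔭), 𝒪)` (§2, `Scheme.ΓSpecIso`); and the transport along
`(iX)^*G ≅ k₀^* k^*G` (Mathlib `Scheme.Modules.pullbackComp`/`pullbackCongr`, ★ `pullbackComp_inv_app_unitSection`) of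
both the `Ext¹` hypothesis and the pulled-back sections.  §1–§2 are ring-level bookkeeping (`private`).

Everything is proved; no named facts.  Universe `Scheme.{0}`.  Mathlib searched (pin): `Localization.AtPrime`,
`Ideal.ResidueField`, `IsLocalization.flat`, `RingHom.flat_algebraMap_iff`, `HasRingHomProperty.Spec_iff`,
`Scheme.ΓSpecIso_inv_naturality`, `IsLocalRing.of_surjective'`, `Ideal.Quotient.lift`, `IsPullback.of_right`,
`MorphismProperty.pullback_snd`, `Ext.comp_assoc_of_second_deg_zero`, `Ext.mk₀_comp_mk₀` (used).  Cell `hodgecm-mathlib`,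
F-DAG (h2) geometric glue (B-p19 (g14)); consumer B-p20 (g10) leaf (B) / (B3); generic, count-neutral, books 0.  HC_CM is
proved only modulo the 7 printed citations until rung 0 closes — nothing here bears on a summit statement.

## References

* D. Mumford, *Abelian Varieties*, TIFR Studies in Mathematics 5 (1970), §5, Cor. 3 (p. 53). [MumfordAV1970]
* R. Hartshorne, *Algebraic Geometry*, GTM 52 (1977), III Thm. 12.11 (p. 290). [Hartshorne1977]
* A. Grothendieck, EGA III₂ (Publ. Math. IHÉS 17, 1963), 7.7.10; EGA III₁ (1961), 4.7.1. [EGAIII2]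
-/

noncomputable section

set_option backward.isDefEq.respectTransparency false

open CategoryTheory CategoryTheory.Limits CategoryTheory.Abelian Opposite TopologicalSpace AlgebraicGeometry TensorProduct
open Literature.Algebra.Homology Literature.Algebra.Module

namespace Literature.AlgebraicGeometry.Morphisms

open Literature.AlgebraicGeometry.Modules Literature.AlgebraicGeometry.HodgeTheory Literature.AlgebraicGeometry.Motives

/-! ## §1 The local base `Spec A_𝔭` and its closed point: ring-level bookkeeping -/

section LocalBase

variable {A : Type} [CommRing A] (𝔭 : Ideal A) [𝔭.IsPrime]

/-- `Γ(Spec R, 𝒪)` is a local ring when `R` is. [folklore] -/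
private theorem isLocalRing_Γ_Spec (R : Type) [CommRing R] [IsLocalRing R] :
    IsLocalRing Γ(Spec (CommRingCat.of R), ⊤) :=
  haveI : Nontrivial Γ(Spec (CommRingCat.of R), ⊤) :=
    (Scheme.ΓSpecIso (CommRingCat.of R)).symm.commRingCatIsoToRingEquiv.injective.nontrivial
  IsLocalRing.of_surjective' (Scheme.ΓSpecIso (CommRingCat.of R)).inv.hom
    (Scheme.ΓSpecIso (CommRingCat.of R)).symm.commRingCatIsoToRingEquiv.surjective

/-- `Spec.map φ` on global sections, in `appLE ⊤ ⊤` form, is `φ` conjugated by `ΓSpecIso`. [folklore] -/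
private theorem appLE_SpecMap_apply {R S : Type} [CommRing R] [CommRing S] (φ : R →+* S) (r : Γ(Spec (CommRingCat.of R), ⊤)) :
    ((Spec.map (CommRingCat.ofHom φ)).appLE ⊤ ⊤ le_top).hom r =
      (Scheme.ΓSpecIso (CommRingCat.of S)).inv (φ ((Scheme.ΓSpecIso (CommRingCat.of R)).hom r)) := by
  have h := Scheme.ΓSpecIso_inv_naturality (CommRingCat.ofHom φ)
  have h' := congrArg (fun ψ => ψ.hom ((Scheme.ΓSpecIso (CommRingCat.of R)).hom r)) h
  simp only [CommRingCat.hom_comp, RingHom.comp_apply, CommRingCat.hom_ofHom] at h'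
  have e1 : (homOfLE (le_top : (⊤ : (Spec (CommRingCat.of S)).Opens) ≤
      (Spec.map (CommRingCat.ofHom φ)) ⁻¹ᵁ ⊤)) = 𝟙 ⊤ := Subsingleton.elim _ _
  change ((Spec.map (CommRingCat.ofHom φ)).app ⊤ ≫
    (Spec (CommRingCat.of S)).presheaf.map (homOfLE le_top).op) r = _
  rw [e1, op_id]
  erw [CategoryTheory.Functor.map_id, Category.comp_id]
  rw [h', Iso.hom_inv_id_apply]

end LocalBase

/-! ## §2 The closed point of `Spec R`, `R` local: `Γ(Spec κ(R), 𝒪)` is the residue field of `Γ(Spec R, 𝒪)` -/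

section Residue

variable (R : Type) [CommRing R] [IsLocalRing R]

/-- The ring map of `Spec κ(R) → Spec R` on global sections is onto. [folklore] -/
private theorem surjective_appLE_SpecMap_residue :
    Function.Surjective ((Spec.map (CommRingCat.ofHom (IsLocalRing.residue R))).appLE ⊤ ⊤ le_top).hom := by
  intro y
  obtain ⟨x, hx⟩ := (Scheme.ΓSpecIso (CommRingCat.of (IsLocalRing.ResidueField R))).symm.commRingCatIsoToRingEquiv.surjective y
  obtain ⟨r, rfl⟩ := IsLocalRing.residue_surjective x
  obtain ⟨r', rfl⟩ := (Scheme.ΓSpecIso (CommRingCat.of R)).commRingCatIsoToRingEquiv.surjective r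
  exact ⟨r', by rw [appLE_SpecMap_apply]; exact hx⟩

/-- **`Γ(Spec κ(R), 𝒪) ≅ κ(Γ(Spec R, 𝒪))` linearly over `Γ(Spec R, 𝒪)`** (through the ring map of `Spec κ(R) → Spec R`):
the residue field of the local ring `Γ(Spec R, 𝒪) ≅ R` is identified with the global sections of `Spec κ(R)`. [folklore] -/
private theorem exists_residueField_linearEquiv_Γ_Spec :
    haveI := isLocalRing_Γ_Spec R
    letI := ((Spec.map (CommRingCat.ofHom (IsLocalRing.residue R))).appLE ⊤ ⊤ le_top).hom.toAlgebra
    Nonempty (IsLocalRing.ResidueField Γ(Spec (CommRingCat.of R), ⊤) ≃ₗ[Γ(Spec (CommRingCat.of R), ⊤)]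
      Γ(Spec (CommRingCat.of (IsLocalRing.ResidueField R)), ⊤)) := by
  haveI := isLocalRing_Γ_Spec R
  let φ := ((Spec.map (CommRingCat.ofHom (IsLocalRing.residue R))).appLE ⊤ ⊤ le_top).hom
  letI := φ.toAlgebra
  -- `φ` kills the maximal ideal of `Γ(Spec R, 𝒪)`
  have hφ : ∀ a ∈ IsLocalRing.maximalIdeal Γ(Spec (CommRingCat.of R), ⊤), φ a = 0 := by
    intro a ha
    change ((Spec.map (CommRingCat.ofHom (IsLocalRing.residue R))).appLE ⊤ ⊤ le_top).hom a = 0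
    rw [appLE_SpecMap_apply]
    have ha' : (Scheme.ΓSpecIso (CommRingCat.of R)).hom a ∈ IsLocalRing.maximalIdeal R := by
      rw [IsLocalRing.mem_maximalIdeal] at ha ⊢
      intro hu
      exact ha (by simpa using hu.map (Scheme.ΓSpecIso (CommRingCat.of R)).inv.hom)
    rw [(IsLocalRing.residue_eq_zero_iff _).2 ha', map_zero]
  let ψ : IsLocalRing.ResidueField Γ(Spec (CommRingCat.of R), ⊤) →+*
      Γ(Spec (CommRingCat.of (IsLocalRing.ResidueField R)), ⊤) :=
    Ideal.Quotient.lift _ φ hφ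
  have hψ : ∀ r, ψ (IsLocalRing.residue _ r) = φ r := fun r => Ideal.Quotient.lift_mk _ _ _
  haveI : Nontrivial Γ(Spec (CommRingCat.of (IsLocalRing.ResidueField R)), ⊤) :=
    (Scheme.ΓSpecIso (CommRingCat.of (IsLocalRing.ResidueField R))).symm.commRingCatIsoToRingEquiv.injective.nontrivial
  have hbij : Function.Bijective ψ :=
    ⟨ψ.injective, Ideal.Quotient.lift_surjective_of_surjective _ hφ (surjective_appLE_SpecMap_residue R)⟩
  exact ⟨{ (RingEquiv.ofBijective ψ hbij).toAddEquiv with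
    map_smul' := fun c x => by
      obtain ⟨y, rfl⟩ := IsLocalRing.residue_surjective x
      change ψ (c • IsLocalRing.residue _ y) = φ c * ψ (IsLocalRing.residue _ y)
      rw [Algebra.smul_def, IsLocalRing.ResidueField.algebraMap_eq, map_mul, hψ] }⟩

end Residue

/-! ## §3 Cohomology and base change in degree `0` at a prime of an affine noetherian base -/

section AtPrime

variable {A : Type} [CommRing A] [IsNoetherianRing A] {X : Scheme.{0}} (f : X ⟶ Spec (CommRingCat.of A))
  [IsProper f] [Flat f] (G : X.Modules) (hL : IsFiniteLocallyFree G) (𝔭 : Ideal A) [𝔭.IsPrime]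
  {X₀ : Scheme.{0}} {iX : X₀ ⟶ X} {f₀ : X₀ ⟶ Spec (CommRingCat.of 𝔭.ResidueField)}
  (HX : IsPullback iX f₀ f (Spec.map (CommRingCat.ofHom (algebraMap A 𝔭.ResidueField))))
  (hvan : Subsingleton (Ext.{1} (unitModule X₀) ((Scheme.Modules.pullback iX).obj G) 1))

include hL HX hvan in
/-- **GLOBAL SECTIONS SPAN THE SECTIONS OF THE FIBRE AT A PRIME, given `H¹`-vanishing on that fibre** (Mumford, *Abelian
Varieties*, §5 Cor. 3; Hartshorne III Thm. 12.11; EGA III 7.7.10 — at ONE point, over an arbitrary affine noetherian base):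
`f : X → Spec A` proper and flat, `A` noetherian, `G` finite locally free on `X`, `𝔭` a prime of `A`, `X₀ = X ×_A κ(𝔭)`
(ANY cartesian square over `Spec κ(𝔭) → Spec A`, `κ(𝔭) = 𝔭.ResidueField`).  If `Ext¹_{𝒪_{X₀}}(𝒪_{X₀}, G|_{X₀}) = 0`
then `Γ(X₀, G|_{X₀})` is SPANNED over `Γ(Spec κ(𝔭), 𝒪) ≅ κ(𝔭)` by the restrictions `η(t)` of the GLOBAL sections
`t ∈ Γ(X, G)`: `Γ(X, G) ⊗_A κ(𝔭) → Γ(X₀, G|_{X₀})` is onto.  (Localise at `𝔭`: flat base change of `H⁰`,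
★ `Modules/ModuleSectionsFlatBaseChange`; then the local-base theorem ★ `Morphisms/SectionsLiftOfFibreVanishing` over
`Spec A_𝔭`; the fibre of `X ×_A A_𝔭` at the closed point is `X₀` again.)
[cite: MumfordAV1970, §5 Cor. 3 (p. 53)] [cite: Hartshorne1977, III Thm. 12.11 (p. 290)] -/
theorem span_unitSectionLE_top_eq_top_at_prime :
    letI := ((Spec.map (CommRingCat.ofHom (algebraMap A 𝔭.ResidueField))).appLE ⊤ ⊤ le_top).hom.toAlgebra
    Submodule.span Γ(Spec (CommRingCat.of 𝔭.ResidueField), ⊤) (Set.range fun t : SecMod G f.appTop.hom ⊤ =>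
      SecMod.mk (ρ := f₀.appTop.hom) (unitSectionLE iX G (V := ⊤) (U := ⊤) le_top
        (SecMod.val (L := G) (ρ := f.appTop.hom) t))) = ⊤ := by
  letI := ((Spec.map (CommRingCat.ofHom (algebraMap A 𝔭.ResidueField))).appLE ⊤ ⊤ le_top).hom.toAlgebra
  -- the local base `Spec A_𝔭` and its closed point `Spec κ(𝔭)`
  let Ap : Type := Localization.AtPrime 𝔭
  let jl : Spec (CommRingCat.of Ap) ⟶ Spec (CommRingCat.of A) := Spec.map (CommRingCat.ofHom (algebraMap A Ap))
  let j₀ : Spec (CommRingCat.of 𝔭.ResidueField) ⟶ Spec (CommRingCat.of Ap) :=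
    Spec.map (CommRingCat.ofHom (IsLocalRing.residue Ap))
  have hbot : j₀ ≫ jl = Spec.map (CommRingCat.ofHom (algebraMap A 𝔭.ResidueField)) := by
    change Spec.map _ ≫ Spec.map _ = _
    rw [← Spec.map_comp, ← CommRingCat.ofHom_comp]
    rfl
  -- `X ×_A A_𝔭`
  let kl : pullback f jl ⟶ X := pullback.fst f jl
  let gl : pullback f jl ⟶ Spec (CommRingCat.of Ap) := pullback.snd f jl
  have Hl : IsPullback kl gl f jl := IsPullback.of_hasPullback f jl
  haveI : IsProper gl := MorphismProperty.pullback_snd (P := @IsProper) f jl inferInstance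
  haveI : Flat gl := MorphismProperty.pullback_snd (P := @Flat) f jl inferInstance
  haveI : IsLocalRing Γ(Spec (CommRingCat.of Ap), ⊤) := isLocalRing_Γ_Spec Ap
  -- the fibre square sits over the closed point of the local base
  have HX' : IsPullback iX f₀ f (j₀ ≫ jl) := by rw [hbot]; exact HX
  let k₀ : X₀ ⟶ pullback f jl := pullback.lift iX (f₀ ≫ j₀) (by rw [Category.assoc, hbot]; exact HX.w)
  have hk₀ : k₀ ≫ kl = iX := pullback.lift_fst _ _ _
  have hk₀' : k₀ ≫ gl = f₀ ≫ j₀ := pullback.lift_snd _ _ _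
  have H₀ : IsPullback k₀ f₀ gl j₀ := IsPullback.of_right (by rw [hk₀]; exact HX') hk₀' Hl
  -- the vector bundle on `X ×_A A_𝔭` and the residue-field identification
  have hLl : IsFiniteLocallyFree ((Scheme.Modules.pullback kl).obj G) := hL.pullback kl
  obtain ⟨e₀⟩ := exists_residueField_linearEquiv_Γ_Spec Ap
  have hj₀ := surjective_appLE_SpecMap_residue Ap
  -- notation for the three rings of sections and the three pull-back maps
  let ρ : Γ(Spec (CommRingCat.of A), ⊤) →+* Γ(X, ⊤) := f.appTop.hom
  let ρl : Γ(Spec (CommRingCat.of Ap), ⊤) →+* Γ(pullback f jl, ⊤) := gl.appTop.hom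
  let ρ₀ : Γ(Spec (CommRingCat.of 𝔭.ResidueField), ⊤) →+* Γ(X₀, ⊤) := f₀.appTop.hom
  let Gl : (pullback f jl).Modules := (Scheme.Modules.pullback kl).obj G
  let G₀ : X₀.Modules := (Scheme.Modules.pullback k₀).obj Gl
  let ηX : SecMod G ρ ⊤ → SecMod ((Scheme.Modules.pullback iX).obj G) ρ₀ ⊤ := fun t =>
    SecMod.mk (ρ := ρ₀) (unitSectionLE iX G (V := ⊤) (U := ⊤) le_top (SecMod.val (L := G) (ρ := ρ) t))
  let ηl : SecMod G ρ ⊤ → SecMod Gl ρl ⊤ := fun t =>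
    SecMod.mk (ρ := ρl) (unitSectionLE kl G (V := ⊤) (U := ⊤) le_top (SecMod.val (L := G) (ρ := ρ) t))
  let η₀ : SecMod Gl ρl ⊤ → SecMod G₀ ρ₀ ⊤ := fun u =>
    SecMod.mk (ρ := ρ₀) (unitSectionLE k₀ Gl (V := ⊤) (U := ⊤) le_top (SecMod.val (L := Gl) (ρ := ρl) u))
  -- the module isomorphism `Φ : iX^* G ≅ k₀^* kl^* G` and what it does to pulled-back global sections
  let Φ : (Scheme.Modules.pullback iX).obj G ≅ G₀ :=
    (Scheme.Modules.pullbackCongr hk₀.symm).app G ≪≫ ((Scheme.Modules.pullbackComp k₀ kl).app G).symm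
  have hηunit : ∀ {Y Z : Scheme.{0}} (h : Y ⟶ Z) (M : Z.Modules) (m : Γ(M, ⊤)),
      unitSectionLE h M (V := ⊤) (U := ⊤) le_top m = unitSection h M ⊤ m := by
    intro Y Z h M m
    have e1 : (homOfLE (le_top : (⊤ : Y.Opens) ≤ h ⁻¹ᵁ ⊤)) = 𝟙 ⊤ := Subsingleton.elim _ _
    unfold unitSectionLE
    rw [e1, op_id]
    erw [CategoryTheory.Functor.map_id]
    rfl
  have hΦ : ∀ t : SecMod G ρ ⊤, Φ.hom.app ⊤ (SecMod.val (L := (Scheme.Modules.pullback iX).obj G) (ρ := ρ₀) (ηX t)) =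
      SecMod.val (L := G₀) (ρ := ρ₀) (η₀ (ηl t)) := by
    intro t
    change ((Scheme.Modules.pullbackComp k₀ kl).inv.app G).app ⊤
      (((Scheme.Modules.pullbackCongr hk₀.symm).hom.app G).app ⊤
        (unitSectionLE iX G (V := ⊤) (U := ⊤) le_top (SecMod.val (L := G) (ρ := ρ) t))) =
      unitSectionLE k₀ Gl (V := ⊤) (U := ⊤) le_top (unitSectionLE kl G (V := ⊤) (U := ⊤) le_top
        (SecMod.val (L := G) (ρ := ρ) t))
    rw [hηunit, hηunit, hηunit]
    have h1 := pullbackCongr_hom_app_unitSection G hk₀.symm ⊤ (SecMod.val (L := G) (ρ := ρ) t)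
    simp only [eqToHom_refl, op_id] at h1
    change ((Scheme.Modules.pullbackComp k₀ kl).inv.app G).app ((k₀ ≫ kl) ⁻¹ᵁ ⊤)
      (((Scheme.Modules.pullbackCongr hk₀.symm).hom.app G).app (iX ⁻¹ᵁ ⊤)
        (unitSection iX G ⊤ (SecMod.val (L := G) (ρ := ρ) t))) = _
    rw [h1]
    erw [CategoryTheory.Functor.map_id, CategoryTheory.id_apply]
    exact pullbackComp_inv_app_unitSection kl G k₀ ⊤ (SecMod.val (L := G) (ρ := ρ) t)
  -- `Ext¹` vanishing transported along `Φ`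
  have hvan' : Subsingleton (Ext.{1} (unitModule X₀) G₀ 1) := by
    refine ⟨fun x y => ?_⟩
    have key : ∀ z : Ext.{1} (unitModule X₀) G₀ 1,
        z = (z.comp (Ext.mk₀ Φ.inv) (add_zero 1)).comp (Ext.mk₀ Φ.hom) (add_zero 1) := fun z => by
      rw [Ext.comp_assoc_of_second_deg_zero, Ext.mk₀_comp_mk₀, Iso.inv_hom_id, Ext.comp_mk₀_id]
    rw [key x, key y, Subsingleton.elim (x.comp _ _) (y.comp (Ext.mk₀ Φ.inv) (add_zero 1))]
  -- (1) over the local base: the `η₀(u)`, `u ∈ Γ(X ×_A A_𝔭, G)`, span `Γ(X₀, G₀)`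
  have hA := span_unitSectionLE_top_eq_top_of_subsingleton_ext gl Gl hLl H₀ e₀ hvan' H₀
  -- (2) flat base change: the `ηl(t)`, `t ∈ Γ(X, G)`, span `Γ(X ×_A A_𝔭, G)`
  obtain ⟨ι, _, _, U, hcov, hUa⟩ := exists_finite_affine_cover_cechOpen f
  haveI := hL.isVectorBundle.1
  have hG : IsAffineLocalizing G := IsAffineLocalizing.of_isQuasicoherent G
  haveI : Flat jl := by
    change Flat (Spec.map (CommRingCat.ofHom (algebraMap A Ap)))
    rw [HasRingHomProperty.Spec_iff (P := @Flat)]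
    change (algebraMap A Ap).Flat
    rw [RingHom.flat_algebraMap_iff]
    exact IsLocalization.flat Ap 𝔭.primeCompl
  have hflat : (jl.appLE ⊤ ⊤ le_top).hom.Flat :=
    HasRingHomProperty.appLE (P := @Flat) jl inferInstance ⟨⊤, isAffineOpen_top _⟩ ⟨⊤, isAffineOpen_top _⟩ le_top
  have hB := span_unitSectionLE_top_eq_top_of_flat Hl U hcov hUa G hG hflat
  -- (3) combine: the `η₀ (ηl t)` span `Γ(X₀, G₀)` (`η₀` is additive and `j₀♯`-semilinear)
  have hadd : ∀ u₁ u₂, η₀ (u₁ + u₂) = η₀ u₁ + η₀ u₂ := fun u₁ u₂ => by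
    apply SecMod.val_injective (L := G₀) (ρ := ρ₀)
    change unitSectionLE k₀ Gl (V := ⊤) (U := ⊤) le_top
      (SecMod.val (L := Gl) (ρ := ρl) u₁ + SecMod.val (L := Gl) (ρ := ρl) u₂) = _
    rw [unitSectionLE_add]
    rfl
  have hsmul : ∀ (a : Γ(Spec (CommRingCat.of Ap), ⊤)) (u : SecMod Gl ρl ⊤),
      η₀ (a • u) = (j₀.appLE ⊤ ⊤ le_top).hom a • η₀ u := fun a u => by
    apply SecMod.val_injective (L := G₀) (ρ := ρ₀)
    change unitSectionLE k₀ Gl (V := ⊤) (U := ⊤) le_top (toSections ρl ⊤ a • SecMod.val (L := Gl) (ρ := ρl) u) =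
      toSections ρ₀ ⊤ ((j₀.appLE ⊤ ⊤ le_top).hom a) •
        unitSectionLE k₀ Gl (V := ⊤) (U := ⊤) le_top (SecMod.val (L := Gl) (ρ := ρl) u)
    rw [unitSectionLE_smul]
    congr 1
    exact appLE_appLE_eq_of_comm_sq (US := ⊤) (UT := ⊤) (UX := ⊤) (UY := ⊤) H₀.w le_top (fun _ _ => trivial)
      (by rw [Scheme.Hom.preimage_top, Scheme.Hom.preimage_top, top_inf_eq]) a
  have hT₀ : Submodule.span Γ(Spec (CommRingCat.of 𝔭.ResidueField), ⊤) (Set.range fun t => η₀ (ηl t)) = ⊤ := by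
    rw [eq_top_iff, ← hA]
    refine Submodule.span_le.2 ?_
    rintro _ ⟨u, rfl⟩
    have hu : u ∈ Submodule.span Γ(Spec (CommRingCat.of Ap), ⊤) (Set.range ηl) := by rw [hB]; trivial
    refine Submodule.span_induction (p := fun u _ => η₀ u ∈ Submodule.span _ (Set.range fun t => η₀ (ηl t)))
      ?_ ?_ ?_ ?_ hu
    · rintro _ ⟨t, rfl⟩; exact Submodule.subset_span ⟨t, rfl⟩
    · have h := hadd 0 0
      rw [add_zero] at h
      rw [left_eq_add.mp h]
      exact Submodule.zero_mem _
    · intro u₁ u₂ _ _ h₁ h₂; rw [hadd]; exact Submodule.add_mem _ h₁ h₂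
    · intro a u _ h; rw [hsmul]; exact Submodule.smul_mem _ _ h
  -- (4) transport along `Φ`: `Φ (ηX t) = η₀ (ηl t)` and `Φ` is `Γ(Spec κ(𝔭), 𝒪)`-linear on global sections
  let ΦL : SecMod ((Scheme.Modules.pullback iX).obj G) ρ₀ ⊤ →ₗ[Γ(Spec (CommRingCat.of 𝔭.ResidueField), ⊤)]
      SecMod G₀ ρ₀ ⊤ :=
    { toFun := fun x => SecMod.mk (ρ := ρ₀) (Φ.hom.app ⊤ (SecMod.val (L := (Scheme.Modules.pullback iX).obj G) (ρ := ρ₀) x))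
      map_add' := fun x y => by
        apply SecMod.val_injective (L := G₀) (ρ := ρ₀)
        change Φ.hom.app ⊤ (SecMod.val (L := (Scheme.Modules.pullback iX).obj G) (ρ := ρ₀) x +
          SecMod.val (L := (Scheme.Modules.pullback iX).obj G) (ρ := ρ₀) y) = _
        rw [map_add]
        rfl
      map_smul' := fun c x => by
        apply SecMod.val_injective (L := G₀) (ρ := ρ₀)
        change Φ.hom.app ⊤ (toSections ρ₀ ⊤ c • SecMod.val (L := (Scheme.Modules.pullback iX).obj G) (ρ := ρ₀) x) =
          toSections ρ₀ ⊤ c • Φ.hom.app ⊤ (SecMod.val (L := (Scheme.Modules.pullback iX).obj G) (ρ := ρ₀) x)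
        rw [Scheme.Modules.Hom.app_smul] }
  have hΦinj : Function.Injective (Φ.hom.app ⊤) := fun a b hab => by
    have h := congrArg (Φ.inv.app ⊤) hab
    rwa [inv_app_hom_app, inv_app_hom_app] at h
  have hΦL_inj : Function.Injective ΦL := fun x y hxy =>
    SecMod.val_injective (L := (Scheme.Modules.pullback iX).obj G) (ρ := ρ₀)
      (hΦinj (congrArg (SecMod.val (L := G₀) (ρ := ρ₀)) hxy))
  have hΦL_η : ∀ t, ΦL (ηX t) = η₀ (ηl t) := fun t =>
    SecMod.val_injective (L := G₀) (ρ := ρ₀) (hΦ t)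
  -- conclusion
  rw [eq_top_iff]
  rintro x -
  have hx : ΦL x ∈ Submodule.span Γ(Spec (CommRingCat.of 𝔭.ResidueField), ⊤) (Set.range fun t => η₀ (ηl t)) := by
    rw [hT₀]; trivial
  have hsub : Submodule.span Γ(Spec (CommRingCat.of 𝔭.ResidueField), ⊤) (Set.range fun t => η₀ (ηl t)) ≤
      Submodule.map ΦL (Submodule.span _ (Set.range ηX)) := by
    rw [Submodule.span_le]
    rintro _ ⟨t, rfl⟩
    exact ⟨ηX t, Submodule.subset_span ⟨t, rfl⟩, hΦL_η t⟩
  obtain ⟨y, hy, hyx⟩ := hsub hx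
  exact hΦL_inj hyx ▸ hy

end AtPrime

end Literature.AlgebraicGeometry.Morphisms

end
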